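import Summits.QuantumFields.BalabanUV.T4Continuum.Support.NE7SliceCriticalBranchLift
import Summits.QuantumFields.BalabanUV.T4Continuum.Support.NE7MinimiserSectionLift
import Summits.QuantumFields.BalabanUV.T4Continuum.Support.NE7EnvelopeSecondOrder
import HarnessLib

/-!
# NE7MinActC2Lift — THE CONSTRAINED MINIMAL ACTION IS `C²` IN THE DATUM, AND ITS HESSIAN IS THE SCHUR COMPLEMENT OF THE REDUCED ACTION'S HESSIAN (ROAD-G115 §2)

Under the stabiliser-lifting hypothesis (G3′) (✓ p824904 proves it at every small datum; discharged in `NE7MinActC2AllData`), around every minimiser `U♯` over a small unitary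
`N`-periodic datum `V₀`: with the slice package `(Sl, θ_Σ, K, ι_K, z⋆)` of `NE7SliceCriticalBranchLift` and the reduced action `g(y, z) = A(chart_{U♯} θ_Σ(y, ι_K z))` (`C²` at `0`),
(i) `chart_{U♯} θ_Σ(y, ι_K z⋆(y))` is a minimiser over `D_y = chart_{V₀} y` and `minAct(D_y) = w·g(y, z⋆(y))` near `0` (`w = stepWt⁻ʲ⁻¹`); (ii) **`y ↦ minAct(D_y)` is `C²` at `0`** — one degree
more than ✓ `NE7MinimiserC1Lift` —; (iii) its Hessian is the SCHUR COMPLEMENT `D²(minAct∘D)(0)[v, w] = w·D²g(0)[(v, z⋆′(0)v), (w, z⋆′(0)w)]`; (iv) VARIATIONAL BOUND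
`D²(minAct∘D)(0)[v, v] ≤ w·D²g(0)[(v, ζ), (v, ζ)]` for every fibre direction `ζ` (the slice Hessian is coercive, ✓ `slice_critical_branch_of_lift`) — **`minAct_contDiffAt_two_of_lift`**.
MECHANISM: `NE7EnvelopeSecondOrder.envelope_second_order` ∕ `hessian_le_of_psd` (this gen) on `(g, z⋆)` with the critical relation `∂_z g(y, z⋆ y) = 0` and the minimality of the branch
(`NE7MinimiserSectionLift.minimiser_section_of_lift`).
Cell `pub-balaban`, rung (B)+1 sub-cell t4, lineage `b2b-balaban-t4-ne7-p1` (CRUX PROVER NE7 #1 = OWNER of BINDER row NE7), generation 115.  Memo `t4/b2b-balaban-t4-ne7-p1-g115/ROAD-G115.md` §2.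
WHAT ([folklore]; 0 def, 0 sorry; `d = 4`, every `U(n)`, `L ≥ 2`).  HONEST FRAMING (page 1): composition of landed kernel theorems; radii∕constants existential; (G3′) a HYPOTHESIS here; the
slice objects are OURS (existential); `C²`, NOT the analyticity [B11] asserts; nothing of Bałaban's asserted; NOT NE7 as a spine node, NOT NE3; spine 0∕9; finite T⁴ rung (B)+1 — NOT
infinite volume, NOT mass gap, NOT BetaPertH, NOT Clay.
-/

set_option autoImplicit false

open scoped BigOperators Matrix Matrix.Norms.L2Operator Topology
open NormedSpace Finset Set Filter Metric

namespace Summit.QuantumFields.BalabanUV.T4Continuum.NE7MinActC2Lift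

open Literature.MathematicalPhysics.QuantumFieldTheory.Balaban1983to89
open B7Prop1Explicit B7Prop2Explicit
open T4AveragingDeficitWall (IsUnitaryCfg SmallField fineAction)
open T4AveragingDeficitWallBoundary (IsPeriodicCfg)
open AveragingDeficitTorusChart (TDir chart)
open AveragingDeficitTwoLevelPrep (skewSub)
open AveragingDeficitMultiLevelPrep (tower levelQ tower_ne_zero)
open MinimalActionLevels (perWin levelAction stepWt stepWt_pos)
open MinimalActionSandwich (IsMinimiser minAct)
open MinimalActionRate (sfClass)
open NE3EnergyShapes (IsUnitarySite IsPeriodicSite)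
open NE7MinimalOrbitDatumContinuity (thresholds)
open NE7MinimalOrbitUniqueGeneric (minimal_orbit_unique_generic)
open BlockAverageCurrent (smallField_gaugeAct)
open NE7SliceCriticalBranchLift (slice_critical_branch_of_lift)
open NE7MinimiserSectionLift (minimiser_section_of_lift)
open NE7EnvelopeSecondOrder (envelope_second_order hessian_le_of_psd fderiv_fderiv_partial_snd)

noncomputable section

variable {n : Type} [Fintype n] [DecidableEq n]

/-- Calculus letter (generic real normed space `Y`): the second derivative of `w·m` is `w` times that of `m`, for `m` `C²` at `0`. [folklore] -/
theorem fderiv_fderiv_const_mul {Y : Type*} [NormedAddCommGroup Y] [NormedSpace ℝ Y] {m : Y → ℝ} (hm : ContDiffAt ℝ 2 m 0) (w : ℝ) (v u : Y) :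
    fderiv ℝ (fderiv ℝ (fun y : Y => w * m y)) 0 v u = w * fderiv ℝ (fderiv ℝ m) 0 v u := by
  have hmd : ∀ᶠ y : Y in 𝓝 0, DifferentiableAt ℝ m y := (hm.eventually (by simp)).mono fun y hy => hy.differentiableAt (by simp)
  have hDw : fderiv ℝ (fun y : Y => w * m y) =ᶠ[𝓝 0] fun y : Y => w • fderiv ℝ m y := hmd.mono fun y hy => (hy.hasFDerivAt.const_mul w).fderiv
  have hmD : DifferentiableAt ℝ (fderiv ℝ m) 0 := (hm.fderiv_right (by norm_num)).differentiableAt one_ne_zero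
  have h2 : HasFDerivAt (fun y : Y => w • fderiv ℝ m y) (w • fderiv ℝ (fderiv ℝ m) 0) 0 := hmD.hasFDerivAt.const_smul w
  rw [hDw.fderiv_eq, h2.fderiv]
  simp only [smul_apply, smul_eq_mul]

set_option maxHeartbeats 1600000 in
/-- **THE CONSTRAINED MINIMAL ACTION IS `C²` IN THE DATUM WITH SCHUR-COMPLEMENT HESSIAN, UNDER (G3′)** (see the module docstring). [folklore] -/
theorem minAct_contDiffAt_two_of_lift [Nonempty n] {L : ℕ} [NeZero L] (hL : 2 ≤ L) :
    ∃ ε₀ : ℝ, 0 < ε₀ ∧ ∀ ε : ℝ, 0 < ε → ε ≤ ε₀ → ∀ (N : ℕ) [NeZero N], 1 ≤ N →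
      ∃ δV : ℝ, 0 < δV ∧
        ∀ V₀ ∈ {V : Site 4 → Fin 4 → (Matrix n n ℂ)ˣ | IsUnitaryCfg V ∧ IsPeriodicCfg V (N : ℤ) ∧ SmallField V δV},
        ∀ (j : ℕ) (Us : Site 4 → Fin 4 → (Matrix n n ℂ)ˣ), IsMinimiser 4 (sfClass 4 L N ε) L N (j + 1) V₀ Us →
        (∀ s : Site 4 → (Matrix n n ℂ)ˣ, IsUnitarySite s → IsPeriodicSite s (N : ℤ) → gaugeAct s V₀ = V₀ →
            ∃ h : Site 4 → (Matrix n n ℂ)ˣ, IsUnitarySite h ∧ IsPeriodicSite h ((N * L ^ (j + 1) : ℕ) : ℤ) ∧ gaugeAct h Us = Us ∧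
              ∀ z : Site 4, h (((L : ℤ) ^ (j + 1)) • z) = s z) →
        ∃ (Sl : Submodule ℝ (TDir 4 n (L * tower L N j))) (θS : ↥(skewSub 4 n N) × ↥Sl → ↥Sl) (KT : Submodule ℝ (TDir 4 n (L * tower L N j))) (iK : ↥KT →L[ℝ] ↥Sl)
          (zs : ↥(skewSub 4 n N) → ↥KT),
          Sl ≤ skewSub 4 n (L * tower L N j) ∧ ContDiffAt ℝ 2 θS 0 ∧ θS 0 = 0 ∧
          (∀ᶠ p : ↥(skewSub 4 n N) × ↥Sl in 𝓝 0,
            levelQ L N j Us (chart (ContinuousLinearMap.id ℝ (Matrix n n ℂ)) (L * tower L N j) Us ((θS p : ↥Sl) : TDir 4 n (L * tower L N j))) = p.1) ∧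
          (∀ z : ↥KT, ((iK z : ↥Sl) : TDir 4 n (L * tower L N j)) = (z : TDir 4 n (L * tower L N j))) ∧
          ContDiffAt ℝ 1 zs 0 ∧ zs 0 = 0 ∧
          -- (i) the section of minimisers and the reduced-action formula for the minimal action
          (∀ᶠ y : ↥(skewSub 4 n N) in 𝓝 0, IsMinimiser 4 (sfClass 4 L N ε) L N (j + 1) (chart (ContinuousLinearMap.id ℝ (Matrix n n ℂ)) N V₀ (y : TDir 4 n N))
            (chart (ContinuousLinearMap.id ℝ (Matrix n n ℂ)) (L * tower L N j) Us ((θS (y, iK (zs y)) : ↥Sl) : TDir 4 n (L * tower L N j)))) ∧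
          (∀ᶠ y : ↥(skewSub 4 n N) in 𝓝 0, minAct 4 (sfClass 4 L N ε) L N (j + 1) (chart (ContinuousLinearMap.id ℝ (Matrix n n ℂ)) N V₀ (y : TDir 4 n N))
            = ((stepWt 4 L)⁻¹) ^ (j + 1) * fineAction (chart (ContinuousLinearMap.id ℝ (Matrix n n ℂ)) (L * tower L N j) Us ((θS (y, iK (zs y)) : ↥Sl) : TDir 4 n (L * tower L N j))) (perWin 4 (N * L ^ (j + 1)))) ∧
          ContDiffAt ℝ 2 (fun p : ↥(skewSub 4 n N) × ↥KT =>
            fineAction (chart (ContinuousLinearMap.id ℝ (Matrix n n ℂ)) (L * tower L N j) Us ((θS (p.1, iK p.2) : ↥Sl) : TDir 4 n (L * tower L N j))) (perWin 4 (N * L ^ (j + 1)))) 0 ∧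
          -- (ii) `C²`, (iii) the Schur-complement Hessian, (iv) the variational bound
          ContDiffAt ℝ 2 (fun y : ↥(skewSub 4 n N) => minAct 4 (sfClass 4 L N ε) L N (j + 1) (chart (ContinuousLinearMap.id ℝ (Matrix n n ℂ)) N V₀ (y : TDir 4 n N))) 0 ∧
          (∀ v w : ↥(skewSub 4 n N),
            fderiv ℝ (fderiv ℝ (fun y : ↥(skewSub 4 n N) => minAct 4 (sfClass 4 L N ε) L N (j + 1) (chart (ContinuousLinearMap.id ℝ (Matrix n n ℂ)) N V₀ (y : TDir 4 n N)))) 0 v w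
              = ((stepWt 4 L)⁻¹) ^ (j + 1) * fderiv ℝ (fderiv ℝ (fun p : ↥(skewSub 4 n N) × ↥KT =>
            fineAction (chart (ContinuousLinearMap.id ℝ (Matrix n n ℂ)) (L * tower L N j) Us ((θS (p.1, iK p.2) : ↥Sl) : TDir 4 n (L * tower L N j))) (perWin 4 (N * L ^ (j + 1))))) 0 (v, fderiv ℝ zs 0 v) (w, fderiv ℝ zs 0 w)) ∧
          (∀ (v : ↥(skewSub 4 n N)) (ζ : ↥KT),
            fderiv ℝ (fderiv ℝ (fun y : ↥(skewSub 4 n N) => minAct 4 (sfClass 4 L N ε) L N (j + 1) (chart (ContinuousLinearMap.id ℝ (Matrix n n ℂ)) N V₀ (y : TDir 4 n N)))) 0 v v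
              ≤ ((stepWt 4 L)⁻¹) ^ (j + 1) * fderiv ℝ (fderiv ℝ (fun p : ↥(skewSub 4 n N) × ↥KT =>
            fineAction (chart (ContinuousLinearMap.id ℝ (Matrix n n ℂ)) (L * tower L N j) Us ((θS (p.1, iK p.2) : ↥Sl) : TDir 4 n (L * tower L N j))) (perWin 4 (N * L ^ (j + 1))))) 0 (v, ζ) (v, ζ)) := by
  have hL1 : 1 ≤ L := by omega
  obtain ⟨ε₁, hε₁, H⟩ := thresholds (n := n) hL
  obtain ⟨ε₃, hε₃, H3⟩ := minimal_orbit_unique_generic (n := n) hL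
  obtain ⟨ε₅, hε₅, H5⟩ := slice_critical_branch_of_lift (n := n) hL
  obtain ⟨ε₆, hε₆, H6⟩ := minimiser_section_of_lift (n := n) hL
  refine ⟨min ε₁ (min ε₃ (min ε₅ ε₆)), lt_min hε₁ (lt_min hε₃ (lt_min hε₅ hε₆)), fun ε hε hεle N _ hN => ?_⟩
  obtain ⟨-, -, -, H1⟩ := H ε hε (hεle.trans (min_le_left _ _))
  obtain ⟨δ₁, hδ₁, hint₁⟩ := H1 N hN
  obtain ⟨δ₃, hδ₃, huniq⟩ := H3 ε hε (hεle.trans ((min_le_right _ _).trans (min_le_left _ _))) N hN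
  have hS5 := H5 ε hε (hεle.trans ((min_le_right _ _).trans ((min_le_right _ _).trans (min_le_left _ _)))) N hN
  obtain ⟨δ₆, hδ₆, hsec⟩ := H6 ε hε (hεle.trans ((min_le_right _ _).trans ((min_le_right _ _).trans (min_le_right _ _)))) N hN
  refine ⟨min δ₁ (min δ₃ δ₆), lt_min hδ₁ (lt_min hδ₃ hδ₆), fun V₀ hV₀ j Us hUs hlift => ?_⟩
  obtain ⟨hV₀u, hV₀P, hV₀δ⟩ := hV₀
  have hV₀1 : V₀ ∈ {V : Site 4 → Fin 4 → (Matrix n n ℂ)ˣ | IsUnitaryCfg V ∧ IsPeriodicCfg V (N : ℤ) ∧ SmallField V δ₁} :=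
    ⟨hV₀u, hV₀P, MinimalActionRate.SmallField.mono hV₀δ (min_le_left _ _)⟩
  have hV₀3 : V₀ ∈ {V : Site 4 → Fin 4 → (Matrix n n ℂ)ˣ | IsUnitaryCfg V ∧ IsPeriodicCfg V (N : ℤ) ∧ SmallField V δ₃} :=
    ⟨hV₀u, hV₀P, MinimalActionRate.SmallField.mono hV₀δ ((min_le_right _ _).trans (min_le_left _ _))⟩
  have hV₀6 : V₀ ∈ {V : Site 4 → Fin 4 → (Matrix n n ℂ)ˣ | IsUnitaryCfg V ∧ IsPeriodicCfg V (N : ℤ) ∧ SmallField V δ₆} :=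
    ⟨hV₀u, hV₀P, MinimalActionRate.SmallField.mono hV₀δ ((min_le_right _ _).trans (min_le_right _ _))⟩
  -- interiority of `U♯` (via the orbit of an interior minimiser)
  obtain ⟨U₀, hU₀, a, ha0, haε, hU₀a⟩ := hint₁ V₀ hV₀1 (j + 1)
  obtain ⟨Ur, -, horbit⟩ := huniq V₀ hV₀3 (j + 1)
  obtain ⟨u₁, hu₁, -, hg₁⟩ := horbit U₀ hU₀
  obtain ⟨u₂, hu₂, -, hg₂⟩ := horbit Us hUs
  have hUsa : SmallField Us a := by
    have h1 : SmallField Ur a := by rw [← hg₁]; exact smallField_gaugeAct hu₁ hU₀a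
    have h2 : gaugeAct (fun z => (u₂ z)⁻¹) Ur = Us := by rw [← hg₂, AveragingDeficitKDatum.gaugeAct_inv_gaugeAct]
    rw [← h2]; exact smallField_gaugeAct (fun z => (unitaryUnits _).inv_mem (hu₂ z)) h1
  haveI : NeZero (L * tower L N j) := ⟨Nat.mul_ne_zero (NeZero.ne L) (tower_ne_zero L N j)⟩
  -- (S5) the slice package and the critical branch; (S6) the branch is a section of minimisers
  obtain ⟨Sl, ξ, σ, θS, KT, iK, πT, zs, hSlle, hξc, hσc, hξ0, hσ0, hprop, hright, hθSc, hθS0, hfibS, hiK, -, hπTsec, hKp, hgc, hzsc, hzs0, hcoer, hzscrit, hzsuniq⟩ :=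
    hS5 V₀ j Us hV₀u hV₀P hUs a ha0 haε hUsa hlift
  have hkey := hsec V₀ hV₀6 j Us hUs hlift Sl ξ σ θS KT iK πT zs hξc hσc hξ0 hσ0 hprop hright hfibS hiK hπTsec hKp hzsuniq
  haveI : CompleteSpace ↥Sl := FiniteDimensional.complete ℝ _
  haveI : CompleteSpace ↥KT := FiniteDimensional.complete ℝ _
  set w : ℝ := ((stepWt 4 L)⁻¹) ^ (j + 1) with hw
  have hw0 : 0 < w := pow_pos (inv_pos.mpr (stepWt_pos (d := 4) L hL1)) _
  have hlev : ∀ Z : Site 4 → Fin 4 → (Matrix n n ℂ)ˣ, levelAction 4 L N (j + 1) Z = w * fineAction Z (perWin 4 (N * L ^ (j + 1))) := fun Z => by rw [hw]; rfl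
  set g : ↥(skewSub 4 n N) × ↥KT → ℝ := fun p : ↥(skewSub 4 n N) × ↥KT =>
    fineAction (chart (ContinuousLinearMap.id ℝ (Matrix n n ℂ)) (L * tower L N j) Us ((θS (p.1, iK p.2) : ↥Sl) : TDir 4 n (L * tower L N j)))
      (perWin 4 (N * L ^ (j + 1))) with hg
  have hfib1 : ∀ᶠ p : ↥(skewSub 4 n N) × ↥Sl in 𝓝 0,
      levelQ L N j Us (chart (ContinuousLinearMap.id ℝ (Matrix n n ℂ)) (L * tower L N j) Us ((θS p : ↥Sl) : TDir 4 n (L * tower L N j))) = p.1 := hfibS.mono fun p hp => hp.1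
  -- (i) the reduced-action formula for the minimal action
  have hminAct : ∀ᶠ y : ↥(skewSub 4 n N) in 𝓝 0,
      minAct 4 (sfClass 4 L N ε) L N (j + 1) (chart (ContinuousLinearMap.id ℝ (Matrix n n ℂ)) N V₀ (y : TDir 4 n N)) = w * g (y, zs y) :=
    hkey.mono fun y hy => by rw [hy.minAct_eq, hlev]
  -- the second-order envelope theorem on `(g, z⋆)`
  have hcrit : ∀ᶠ y : ↥(skewSub 4 n N) in 𝓝 0, fderiv ℝ (fun z : ↥KT => g (y, z)) (zs y) = 0 := hzscrit
  obtain ⟨-, hm2, -, h4⟩ := envelope_second_order hgc hzsc hzs0 hcrit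
  obtain ⟨c, hc, hcoer'⟩ := hcoer
  have hpsd : ∀ η : ↥KT, 0 ≤ fderiv ℝ (fderiv ℝ g) 0 ((0 : ↥(skewSub 4 n N)), η) ((0 : ↥(skewSub 4 n N)), η) := fun η => by
    rw [← fderiv_fderiv_partial_snd hgc η η]
    exact le_trans (by positivity) (hcoer' η)
  have hle : ∀ (v : ↥(skewSub 4 n N)) (ζ : ↥KT), fderiv ℝ (fderiv ℝ (fun y : ↥(skewSub 4 n N) => g (y, zs y))) 0 v v ≤ fderiv ℝ (fderiv ℝ g) 0 (v, ζ) (v, ζ) :=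
    hessian_le_of_psd hgc hzsc hzs0 hcrit hpsd
  -- `minAct ∘ D = w · m₀` near `0`: `C²` and the Hessian
  have hwm2 : ContDiffAt ℝ 2 (fun y : ↥(skewSub 4 n N) => w * g (y, zs y)) 0 := contDiffAt_const.mul hm2
  have hM2 : ContDiffAt ℝ 2 (fun y : ↥(skewSub 4 n N) => minAct 4 (sfClass 4 L N ε) L N (j + 1) (chart (ContinuousLinearMap.id ℝ (Matrix n n ℂ)) N V₀ (y : TDir 4 n N))) 0 :=
    hwm2.congr_of_eventuallyEq hminAct
  have hHess : ∀ v w' : ↥(skewSub 4 n N),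
      fderiv ℝ (fderiv ℝ (fun y : ↥(skewSub 4 n N) => minAct 4 (sfClass 4 L N ε) L N (j + 1) (chart (ContinuousLinearMap.id ℝ (Matrix n n ℂ)) N V₀ (y : TDir 4 n N)))) 0 v w'
        = w * fderiv ℝ (fderiv ℝ g) 0 (v, fderiv ℝ zs 0 v) (w', fderiv ℝ zs 0 w') := fun v w' => by
    have hEq : (fun y : ↥(skewSub 4 n N) => minAct 4 (sfClass 4 L N ε) L N (j + 1) (chart (ContinuousLinearMap.id ℝ (Matrix n n ℂ)) N V₀ (y : TDir 4 n N)))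
        =ᶠ[𝓝 0] fun y : ↥(skewSub 4 n N) => w * g (y, zs y) := hminAct
    rw [hEq.fderiv.fderiv_eq, fderiv_fderiv_const_mul hm2 w v w', h4]
  refine ⟨Sl, θS, KT, iK, zs, hSlle, hθSc, hθS0, hfib1, hiK, hzsc, hzs0, hkey, hminAct, hgc, hM2, hHess, fun v ζ => ?_⟩
  rw [hHess]
  exact mul_le_mul_of_nonneg_left (by rw [← h4]; exact hle v ζ) hw0.le

end

end Summit.QuantumFields.BalabanUV.T4Continuum.NE7MinActC2Lift
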